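import Literature.NumberTheory.Rogawski1990.RankOneUnstableRamifiedUnitSimilitude        -- ★ p843548 A-p19 (g23): R-0 package `exists_unitSimilitudePartner_of_ramified` (`e = (Ad diag(1,r), id)`, `hest`, LEVEL, HAAR); brings ★ p843033, ★ p842188
import Literature.NumberTheory.Automorphic.OrbitalIntegralHaarAutomorphismTransport    -- ★ `IsCanonical.classOrbitalIntegral_comp_continuousMulEquiv_eq` (Haar-preserving automorphisms transport CANONICAL class orbital integrals)
import HarnessLib

/-!
# (R1-ram, R-1) THE RAMIFIED UNIT ROW IN THE LETTER'S OWN TOKENS: `Δ(t)·(2Φ(⟦t⟧, 𝟙_{K_H}; m) − Σᶠ_{d ∼_st t} Φ(d, 𝟙_{K_H}; m)) = 0` at a place ramified in `L ∕ L⁺`,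
# and the closed form `Φ^κ(t, f; m) = Φ(⟦t⟧, f; m) − Φ(⟦t⟧, f ∘ e; m)` for the stable partner `e` (Labesse–Langlands 1979 §2 p. 9–10; Rogawski 1990 Lemma 4.9.3, §4.3)

Topic `NumberTheory/Rogawski1990`; namespace `Literature.NumberTheory.Rogawski1990`.  THEOREMS ONLY (no definition, no instance, no notation, no named fact, no `sorry`).
Cell `pub/hodgecm-mathlib` (D-0151), crux H413 = `stmt-HodgeConjecture-24833`, line «N6nsGerm» stub `stub_N6nsR1LL : RankOneUnstableTransferNonsplitCME`, residue ★
`RankOneUnstableTransferNonsplitCMERamified` (ED. 4 :319); road «R1-ram» (architect A-p16 (g27) RULINGS A-14 (c), A-21 (c): «F0P3-p02 → R-1, ramified unit-row-zero corollary +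
certificate on a NEW path importing A-p19's file»); seat F0P3-p02 (g13).  HONEST LABEL: HC_CM is proved only modulo the printed citations (the 2 remaining named inputs hLiu418,
h413) until rung 0 closes; this file is the LETTER-LEVEL certificate of ONE row (the unit `𝟙_{K_H}` at a ramified place) — not the ramified letter for a general `f`.

WHAT IS NEW HERE.  ★ p843548 (R-0) proves the unit row on the CORE side (`hcore_ram` of ★ `rankOneUnstableTransferNonsplitCMERamified_of_core`: plain Bochner integrals
`O_ν(t, 𝟙) − O_ν(t′, 𝟙)` at an abstract second class `t′`).  THIS FILE reads it in the LETTER's tokens — Rogawski's CANONICALLY normalised class orbital integrals (★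
`classOrbitalIntegral` of a family `m` ★ `IsCanonical` for `(Reg, ν)`) and the κ-sum over the stable class `2Φ(⟦t⟧) − Σᶠ_{d ∼_st t} Φ(d)` — WITHOUT passing through compact
centralisers or Bochner integrals: a Haar-preserving automorphism `e` transports canonical class orbital integrals (★ `IsCanonical.classOrbitalIntegral_comp_continuousMulEquiv_eq`:
`Φ(⟦e t⟧, f; m) = Φ(⟦t⟧, f ∘ e; m)`, with `Reg (e t)` by the letter's stable closure (r1)), and the stable class of an elliptic regular `t` is `{⟦t⟧, ⟦e t⟧}` (★
`exists_setOf_isLocalStablyConjH_out_eq_pair` + the package's `hest`).  Hence the CLOSED FORM **`Φ^κ(t, f; m) := 2Φ(⟦t⟧, f; m) − Σᶠ_{st} Φ(·, f; m) = Φ(⟦t⟧, f; m) − Φ(⟦t⟧, f ∘ e; m)`**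
for EVERY `f` (Labesse–Langlands' `φ^T(γ, f) = φ(γ, f) − φ(γ, f^h)`, [LL §2 p. 9]), which VANISHES when `f ∘ e = f`; at a RAMIFIED place the partner of ★ p843548 fixes `K_H`, so
`Δ(t)·Φ^κ(t, 𝟙_{K_H}; m) = 0` — «it is clear that `φ^T(γ, f) = 0` if `L` is ramified» [LL p. 9–10] — in the statement shape of the inert certificate ★
`rankOne_lhs_indicator_eq_of_eigenframe_of_guard` (value `0` in place of `μ_v(u₁)⁻¹ C⁻¹ (−1)^e`), and in the `∃ fC` dress of the letter ★ `RankOneUnstableTransferNonsplitCMERamified`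
at one datum (`fC = 0`, locally constant, compactly supported).

* §1 (any non-split `v`; abstract `e : H_v ≃ₜ* H_v` preserving `ν`): `classOrbitalIntegral_mk_congr_eq_comp` (`Φ(⟦e g⟧, f) = Φ(⟦g⟧, f ∘ e)`), `setOf_isLocalStablyConjH_out_eq_pair_congr`
  (`{d | t ∼_st out d} = {⟦t⟧, ⟦e t⟧}`, distinct), **`two_mul_classOrbitalIntegral_sub_finsum_eq_sub`** (the closed form), `two_mul_classOrbitalIntegral_sub_finsum_eq_zero_of_comp_eq`.
* §2 (ramified `v`, over ★ `exists_unitSimilitudePartner_of_ramified`): **`rankOne_letter_lhs_indicator_eq_zero_of_ramified`** (`(w hw he)` binders) and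
  **`exists_letter_indicator_of_not_isUnramifiedIn`** (`(hv hram)` binders: the body of ★ `RankOneUnstableTransferNonsplitCMERamified` at one datum for `f = 𝟙_{K_H}`, `fC = 0`).

## References
* [LabesseLanglands1979] J.-P. Labesse, R. P. Langlands, *L-indistinguishability for SL(2)*, Canad. J. Math. 31 (1979) 726–785: §2, Lemma 2.1, pp. 8–10 («φ^T(γ, f) = 0 if L is ramified»).
* [Rogawski1990] J. D. Rogawski, *Automorphic Representations of Unitary Groups in Three Variables*, Ann. of Math. Stud. 123 (1990): §3.5 Prop. 3.5.2 (c) p. 29, §3.6 pp. 31–32,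
  §4.3 (4.3.1) p. 43 (compatible measures), §4.9 Lemma 4.9.3 (4.9.2) p. 56, Prop. 4.9.1 (b) p. 55.
* [DeitmarEchterhoff2014] A. Deitmar, S. Echterhoff, *Principles of Harmonic Analysis*, 2nd ed. (2014): Thm. 1.5.3.  [Kottwitz1988] R. E. Kottwitz, *Tamagawa numbers*, Ann. of Math. 127 (1988): §2.
-/

set_option autoImplicit false

noncomputable section

open Set Filter Topology MeasureTheory Measure NumberField IsDedekindDomain Matrix
open scoped Matrix MatrixGroups

namespace Literature.NumberTheory.Rogawski1990

open Literature.NumberTheory.Automorphic Literature.NumberTheory.Automorphic.UnitaryGroup Literature.NumberTheory.GaloisRepresentations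
open Literature.MeasureTheory.Group

section Folklore

/-- `(X − a)(X − b)` separable ⇒ `a ≠ b` (over any non-trivial commutative ring). [folklore] -/
private theorem ne_of_separable_X_sub_C_mul₁₃ {K : Type*} [CommRing K] [Nontrivial K] {a b : K}
    (h : ((Polynomial.X - Polynomial.C a) * (Polynomial.X - Polynomial.C b)).Separable) : a ≠ b := by
  rintro rfl
  exact Polynomial.not_isUnit_X_sub_C a (isCoprime_self.1 h.isCoprime)

/-- `![a, b]` with `a ≠ b` is injective. [folklore] -/
private theorem injective_vecCons_two₁₃ {K : Type*} {a b : K} (h : a ≠ b) : Function.Injective ![a, b] := by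
  intro i j hij
  fin_cases i <;> fin_cases j
  · rfl
  · exact absurd hij h
  · exact absurd hij.symm h
  · rfl

variable (L : Type) [Field L] [NumberField L] [IsCMField L] (v : HeightOneSpectrum (𝓞 ↥(maximalRealSubfield L)))

/-- At a place with ONE prime of `L` above it, that prime is fixed by complex conjugation (local copy of ★ `smul_eq_of_subsingleton_placesOver`).
[cite: CasselsFrohlichANT1967, Ch. VII Prop. 1.2 (ii)] -/
private theorem smul_eq_of_subsingleton_placesOver₁₃ (hv : Subsingleton (PlacesOver L v)) (w : PlacesOver L v) : IsCMField.complexConj L • w.1 = w.1 := by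
  have hmem : (IsCMField.complexConj L • w.1).under (𝓞 ↥(maximalRealSubfield L)) = v := by
    rw [HeightOneSpectrum.under_algEquiv_smul]; exact w.2
  exact congrArg Subtype.val (Subsingleton.elim (⟨IsCMField.complexConj L • w.1, hmem⟩ : PlacesOver L v) w)

/-- Conjugate elements of `H_v` are stably conjugate (componentwise ★ `isStablyConj_of_isConj`). [cite: Rogawski1990, §3.1 p. 19] -/
private theorem isLocalStablyConjH_of_isConj₁₃ {a b : (((cmDatum L 2 (Matrix.of fun i j : Fin 2 => if i.val + j.val + 1 = 2 then (1 : L) else 0)).Local v) × ((cmDatum L 1 (Matrix.of fun i j : Fin 1 => if i.val + j.val + 1 = 1 then (1 : L) else 0)).Local v))} (h : IsConj a b) : IsLocalStablyConjH L v a b := by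
  obtain ⟨c, hc⟩ := isConj_iff.1 h
  exact ⟨isStablyConj_of_isConj (isConj_iff.2 ⟨c.1, congrArg Prod.fst hc⟩), isStablyConj_of_isConj (isConj_iff.2 ⟨c.2, congrArg Prod.snd hc⟩)⟩

end Folklore

/-! ## §1 Canonical class orbital integrals at the stable partner; the closed form `Φ^κ(t, f) = Φ(⟦t⟧, f) − Φ(⟦t⟧, f ∘ e)` (every non-split `v`) -/

section Letter

variable (L : Type) [Field L] [NumberField L] [IsCMField L] (v : HeightOneSpectrum (𝓞 ↥(maximalRealSubfield L)))
  [MeasurableSpace (((cmDatum L 2 (Matrix.of fun i j : Fin 2 => if i.val + j.val + 1 = 2 then (1 : L) else 0)).Local v) × ((cmDatum L 1 (Matrix.of fun i j : Fin 1 => if i.val + j.val + 1 = 1 then (1 : L) else 0)).Local v))] [BorelSpace (((cmDatum L 2 (Matrix.of fun i j : Fin 2 => if i.val + j.val + 1 = 2 then (1 : L) else 0)).Local v) × ((cmDatum L 1 (Matrix.of fun i j : Fin 1 => if i.val + j.val + 1 = 1 then (1 : L) else 0)).Local v))] (ν : Measure (((cmDatum L 2 (Matrix.of fun i j : Fin 2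 => if i.val + j.val + 1 = 2 then (1 : L) else 0)).Local v) × ((cmDatum L 1 (Matrix.of fun i j : Fin 1 => if i.val + j.val + 1 = 1 then (1 : L) else 0)).Local v))) [ν.IsHaarMeasure] [ν.IsMulRightInvariant]
  [iZ : ∀ γ : (((cmDatum L 2 (Matrix.of fun i j : Fin 2 => if i.val + j.val + 1 = 2 then (1 : L) else 0)).Local v) × ((cmDatum L 1 (Matrix.of fun i j : Fin 1 => if i.val + j.val + 1 = 1 then (1 : L) else 0)).Local v)), MeasurableSpace ((((cmDatum L 2 (Matrix.of fun i j : Fin 2 => if i.val + j.val + 1 = 2 then (1 : L) else 0)).Local v) × ((cmDatum L 1 (Matrix.of fun i j : Fin 1 => if i.val + j.val + 1 = 1 then (1 : L) else 0)).Local v)) ⧸ Subgroup.centralizer ({γ} : Set (((cmDatum L 2 (Matrix.of fun i j : Fin 2 => if i.val + j.val + 1 = 2 then (1 : L) else 0)).Local v) × ((cmDatum L 1 (Matrix.of fun i j : Fin 1 => if i.val + j.val + 1 = 1 then (1 : L) else 0)).Local v))))]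
  [bZ : ∀ γ : (((cmDatum L 2 (Matrix.of fun i j : Fin 2 => if i.val + j.val + 1 = 2 then (1 : L) else 0)).Local v) × ((cmDatum L 1 (Matrix.of fun i j : Fin 1 => if i.val + j.val + 1 = 1 then (1 : L) else 0)).Local v)), BorelSpace ((((cmDatum L 2 (Matrix.of fun i j : Fin 2 => if i.val + j.val + 1 = 2 then (1 : L) else 0)).Local v) × ((cmDatum L 1 (Matrix.of fun i j : Fin 1 => if i.val + j.val + 1 = 1 then (1 : L) else 0)).Local v)) ⧸ Subgroup.centralizer ({γ} : Set (((cmDatum L 2 (Matrix.of fun i j : Fin 2 => if i.val + j.val + 1 = 2 then (1 : L) else 0)).Local v) × ((cmDatum L 1 (Matrix.of fun i j : Fin 1 => if i.val + j.val + 1 = 1 then (1 : L) else 0)).Local v))))]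

/-- **CANONICAL CLASS ORBITAL INTEGRALS AT THE PARTNER: `Φ(⟦e g⟧, f; m) = Φ(⟦g⟧, f ∘ e; m)`** for a topological-group automorphism `e` of `H_v` preserving the Haar measure `ν`, a family `m`
CANONICAL for `(Reg, ν)` with `Reg` conjugation-closed and STABLY closed (the letter's (r1)), `g` with `Reg g` and `e g` stably conjugate to `g` (★
`IsCanonical.classOrbitalIntegral_comp_continuousMulEquiv_eq`: «the orbital integrals are defined using compatible measures» [Rogawski1990 §4.3]).
[cite: Rogawski1990, §4.3 (4.3.1) p. 43] [cite: DeitmarEchterhoff2014, Thm. 1.5.3] [cite: LabesseLanglands1979, §2 p. 9] -/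
theorem classOrbitalIntegral_mk_congr_eq_comp {m : OrbitalMeasureFamily (((cmDatum L 2 (Matrix.of fun i j : Fin 2 => if i.val + j.val + 1 = 2 then (1 : L) else 0)).Local v) × ((cmDatum L 1 (Matrix.of fun i j : Fin 1 => if i.val + j.val + 1 = 1 then (1 : L) else 0)).Local v))} {Reg : (((cmDatum L 2 (Matrix.of fun i j : Fin 2 => if i.val + j.val + 1 = 2 then (1 : L) else 0)).Local v) × ((cmDatum L 1 (Matrix.of fun i j : Fin 1 => if i.val + j.val + 1 = 1 then (1 : L) else 0)).Local v)) → Prop}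
    (hconj : ∀ γ x, Reg γ → Reg (x * γ * x⁻¹)) (hstab : ∀ γ δ, Reg γ → IsLocalStablyConjH L v γ δ → Reg δ) (hm : m.IsCanonical Reg ν)
    (e : (((cmDatum L 2 (Matrix.of fun i j : Fin 2 => if i.val + j.val + 1 = 2 then (1 : L) else 0)).Local v) × ((cmDatum L 1 (Matrix.of fun i j : Fin 1 => if i.val + j.val + 1 = 1 then (1 : L) else 0)).Local v)) ≃ₜ* (((cmDatum L 2 (Matrix.of fun i j : Fin 2 => if i.val + j.val + 1 = 2 then (1 : L) else 0)).Local v) × ((cmDatum L 1 (Matrix.of fun i j : Fin 1 => if i.val + j.val + 1 = 1 then (1 : L) else 0)).Local v))) (he : MeasurePreserving e ν ν) (g : (((cmDatum L 2 (Matrix.of fun i j : Fin 2 => if i.val + j.val + 1 = 2 then (1 : L) else 0)).Local v) × ((cmDatum L 1 (Matrix.of fun i j : Fin 1 => if i.val + j.val + 1 = 1 then (1 : L) else 0)).Local v))) (hg : Reg g) (hst : IsLocalStablyConjH L v g (e g)) (f : (((cmDatum L 2 (Matrix.of fun i j : Fin 2 => if i.val + j.val + 1 = 2 then (1 : L) else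 0)).Local v) × ((cmDatum L 1 (Matrix.of fun i j : Fin 1 => if i.val + j.val + 1 = 1 then (1 : L) else 0)).Local v)) → ℂ) :
    classOrbitalIntegral m f (ConjClasses.mk (e g)) = classOrbitalIntegral m (f ∘ e) (ConjClasses.mk g) :=
  (hm.classOrbitalIntegral_comp_continuousMulEquiv_eq hconj e he.map_eq hg (hstab _ _ hg hst) f).symm

omit [MeasurableSpace (((cmDatum L 2 (Matrix.of fun i j : Fin 2 => if i.val + j.val + 1 = 2 then (1 : L) else 0)).Local v) × ((cmDatum L 1 (Matrix.of fun i j : Fin 1 => if i.val + j.val + 1 = 1 then (1 : L) else 0)).Local v))] [BorelSpace (((cmDatum L 2 (Matrix.of fun i j : Fin 2 => if i.val + j.val + 1 = 2 then (1 : L) else 0)).Local v) × ((cmDatum L 1 (Matrix.of fun i j : Fin 1 => if i.val + j.val + 1 = 1 then (1 : L) else 0)).Local v))] iZ bZ in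
/-- **THE STABLE CLASS OF AN ELLIPTIC REGULAR `t` IS `{⟦t⟧, ⟦e t⟧}` (two DISTINCT classes)** for any `e : H_v → H_v` with `e t` stably conjugate and not conjugate to `t` — `t ∈ Z(t₀)` with
`t.1` regular, `t₀` framed by `(P, d)` with norm-one eigenvalues (★ `normOne_frame_of_mem_centralizer`, ★ `exists_setOf_isLocalStablyConjH_out_eq_pair`).
[cite: Rogawski1990, §3.5 Prop. 3.5.2 (c) p. 29; §3.6 pp. 31–32] [cite: LabesseLanglands1979, §2 pp. 8–9] -/
theorem setOf_isLocalStablyConjH_out_eq_pair_congr (w : PlacesOver L v) (hw : IsCMField.complexConj L • w.1 = w.1) (e : (((cmDatum L 2 (Matrix.of fun i j : Fin 2 => if i.val + j.val + 1 = 2 then (1 : L) else 0)).Local v) × ((cmDatum L 1 (Matrix.of fun i j : Fin 1 => if i.val + j.val + 1 = 1 then (1 : L) else 0)).Local v)) ≃ₜ* (((cmDatum L 2 (Matrix.of fun i j : Fin 2 => if i.val + j.val + 1 = 2 then (1 : L) else 0)).Local v) × ((cmDatum L 1 (Matrix.of fun i j : Fin 1 => if i.val + j.val + 1 = 1 then (1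 : L) else 0)).Local v)))
    (t₀ : (((cmDatum L 2 (Matrix.of fun i j : Fin 2 => if i.val + j.val + 1 = 2 then (1 : L) else 0)).Local v) × ((cmDatum L 1 (Matrix.of fun i j : Fin 1 => if i.val + j.val + 1 = 1 then (1 : L) else 0)).Local v))) (P : GL (Fin 2) (LocalRing L v)) (d : Fin 2 → LocalRing L v) (ht₀ : IsRegularElt (t₀.1.val : GL (Fin 2) (LocalRing L v)))
    (hP : (t₀.1.val.val : Matrix (Fin 2) (Fin 2) (LocalRing L v)) * P.val = P.val * Matrix.diagonal d) (hd1 : ∀ i, (conjLocal L (IsCMField.complexConj L) v) (d i) * d i = 1)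
    (t : ↥(Subgroup.centralizer ({t₀} : Set (((cmDatum L 2 (Matrix.of fun i j : Fin 2 => if i.val + j.val + 1 = 2 then (1 : L) else 0)).Local v) × ((cmDatum L 1 (Matrix.of fun i j : Fin 1 => if i.val + j.val + 1 = 1 then (1 : L) else 0)).Local v))))) (ht : IsRegularElt ((t : (((cmDatum L 2 (Matrix.of fun i j : Fin 2 => if i.val + j.val + 1 = 2 then (1 : L) else 0)).Local v) × ((cmDatum L 1 (Matrix.of fun i j : Fin 1 => if i.val + j.val + 1 = 1 then (1 : L) else 0)).Local v))).1.val : GL (Fin 2) (LocalRing L v)))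
    (hest : IsLocalStablyConjH L v (t : (((cmDatum L 2 (Matrix.of fun i j : Fin 2 => if i.val + j.val + 1 = 2 then (1 : L) else 0)).Local v) × ((cmDatum L 1 (Matrix.of fun i j : Fin 1 => if i.val + j.val + 1 = 1 then (1 : L) else 0)).Local v))) (e (t : (((cmDatum L 2 (Matrix.of fun i j : Fin 2 => if i.val + j.val + 1 = 2 then (1 : L) else 0)).Local v) × ((cmDatum L 1 (Matrix.of fun i j : Fin 1 => if i.val + j.val + 1 = 1 then (1 : L) else 0)).Local v)))) ∧ ¬ IsConj (t : (((cmDatum L 2 (Matrix.of fun i j : Fin 2 => if i.val + j.val + 1 = 2 then (1 : L) else 0)).Local v) × ((cmDatum L 1 (Matrix.of fun i j : Fin 1 => if i.val + j.val + 1 = 1 then (1 : L) else 0)).Local v))) (e (t : (((cmDatum L 2 (Matrix.of fun i j : Fin 2 => if i.val + j.val + 1 = 2 then (1 : L) else 0)).Local v) × ((cmDatum L 1 (Matrix.of fun i j : Fin 1 => if i.val + j.val + 1 = 1 then (1 : L) else 0)).Local v))))) :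
    ConjClasses.mk (t : (((cmDatum L 2 (Matrix.of fun i j : Fin 2 => if i.val + j.val + 1 = 2 then (1 : L) else 0)).Local v) × ((cmDatum L 1 (Matrix.of fun i j : Fin 1 => if i.val + j.val + 1 = 1 then (1 : L) else 0)).Local v))) ≠ ConjClasses.mk (e (t : (((cmDatum L 2 (Matrix.of fun i j : Fin 2 => if i.val + j.val + 1 = 2 then (1 : L) else 0)).Local v) × ((cmDatum L 1 (Matrix.of fun i j : Fin 1 => if i.val + j.val + 1 = 1 then (1 : L) else 0)).Local v)))) ∧
      {c : ConjClasses (((cmDatum L 2 (Matrix.of fun i j : Fin 2 => if i.val + j.val + 1 = 2 then (1 : L) else 0)).Local v) × ((cmDatum L 1 (Matrix.of fun i j : Fin 1 => if i.val + j.val + 1 = 1 then (1 : L) else 0)).Local v)) | IsLocalStablyConjH L v (t : (((cmDatum L 2 (Matrix.of fun i j : Fin 2 => if i.val + j.val + 1 = 2 then (1 : L) else 0)).Local v) × ((cmDatum L 1 (Matrix.of fun i j : Fin 1 => if i.val + j.val + 1 = 1 then (1 : L) else 0)).Local v))) (Quotient.out c)} = {ConjClasses.mk (t : (((cmDatum L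 2 (Matrix.of fun i j : Fin 2 => if i.val + j.val + 1 = 2 then (1 : L) else 0)).Local v) × ((cmDatum L 1 (Matrix.of fun i j : Fin 1 => if i.val + j.val + 1 = 1 then (1 : L) else 0)).Local v))), ConjClasses.mk (e (t : (((cmDatum L 2 (Matrix.of fun i j : Fin 2 => if i.val + j.val + 1 = 2 then (1 : L) else 0)).Local v) × ((cmDatum L 1 (Matrix.of fun i j : Fin 1 => if i.val + j.val + 1 = 1 then (1 : L) else 0)).Local v))))} := by
  haveI : Nontrivial (LocalRing L v) := ⟨⟨0, 1, fun h01 => zero_ne_one (congrFun h01 w)⟩⟩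
  obtain ⟨hτ1, hframe⟩ := normOne_frame_of_mem_centralizer L v w hw t₀ P d ht₀ hP hd1 (t : (((cmDatum L 2 (Matrix.of fun i j : Fin 2 => if i.val + j.val + 1 = 2 then (1 : L) else 0)).Local v) × ((cmDatum L 1 (Matrix.of fun i j : Fin 1 => if i.val + j.val + 1 = 1 then (1 : L) else 0)).Local v))) t.2
  have hτ01 : ((P⁻¹).val * ((t : (((cmDatum L 2 (Matrix.of fun i j : Fin 2 => if i.val + j.val + 1 = 2 then (1 : L) else 0)).Local v) × ((cmDatum L 1 (Matrix.of fun i j : Fin 1 => if i.val + j.val + 1 = 1 then (1 : L) else 0)).Local v))).1.val.val : Matrix (Fin 2) (Fin 2) (LocalRing L v)) * P.val) 0 0 ≠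
      ((P⁻¹).val * ((t : (((cmDatum L 2 (Matrix.of fun i j : Fin 2 => if i.val + j.val + 1 = 2 then (1 : L) else 0)).Local v) × ((cmDatum L 1 (Matrix.of fun i j : Fin 1 => if i.val + j.val + 1 = 1 then (1 : L) else 0)).Local v))).1.val.val : Matrix (Fin 2) (Fin 2) (LocalRing L v)) * P.val) 1 1 := by
    have hsep : (finCharpolyTwo L v (t : (((cmDatum L 2 (Matrix.of fun i j : Fin 2 => if i.val + j.val + 1 = 2 then (1 : L) else 0)).Local v) × ((cmDatum L 1 (Matrix.of fun i j : Fin 1 => if i.val + j.val + 1 = 1 then (1 : L) else 0)).Local v)))).Separable := ht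
    rw [finCharpolyTwo_eq_of_frame P hframe] at hsep
    exact ne_of_separable_X_sub_C_mul₁₃ hsep
  obtain ⟨d', hne, hset⟩ := exists_setOf_isLocalStablyConjH_out_eq_pair L w hw hframe (injective_vecCons_two₁₃ hτ01) hτ1
  have hout : ∀ c : ConjClasses (((cmDatum L 2 (Matrix.of fun i j : Fin 2 => if i.val + j.val + 1 = 2 then (1 : L) else 0)).Local v) × ((cmDatum L 1 (Matrix.of fun i j : Fin 1 => if i.val + j.val + 1 = 1 then (1 : L) else 0)).Local v)), ConjClasses.mk (Quotient.out c) = c := fun c => by rw [← ConjClasses.quotient_mk_eq_mk, Quotient.out_eq]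
  have hne' : ConjClasses.mk (t : (((cmDatum L 2 (Matrix.of fun i j : Fin 2 => if i.val + j.val + 1 = 2 then (1 : L) else 0)).Local v) × ((cmDatum L 1 (Matrix.of fun i j : Fin 1 => if i.val + j.val + 1 = 1 then (1 : L) else 0)).Local v))) ≠ ConjClasses.mk (e (t : (((cmDatum L 2 (Matrix.of fun i j : Fin 2 => if i.val + j.val + 1 = 2 then (1 : L) else 0)).Local v) × ((cmDatum L 1 (Matrix.of fun i j : Fin 1 => if i.val + j.val + 1 = 1 then (1 : L) else 0)).Local v)))) := fun h => hest.2 (ConjClasses.mk_eq_mk_iff_isConj.1 h)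
  -- `⟦e t⟧` lies in the stable class, hence is `d′`
  have hst : IsLocalStablyConjH L v (t : (((cmDatum L 2 (Matrix.of fun i j : Fin 2 => if i.val + j.val + 1 = 2 then (1 : L) else 0)).Local v) × ((cmDatum L 1 (Matrix.of fun i j : Fin 1 => if i.val + j.val + 1 = 1 then (1 : L) else 0)).Local v))) (Quotient.out (ConjClasses.mk (e (t : (((cmDatum L 2 (Matrix.of fun i j : Fin 2 => if i.val + j.val + 1 = 2 then (1 : L) else 0)).Local v) × ((cmDatum L 1 (Matrix.of fun i j : Fin 1 => if i.val + j.val + 1 = 1 then (1 : L) else 0)).Local v)))))) :=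
    hest.1.trans (isLocalStablyConjH_of_isConj₁₃ L v (ConjClasses.mk_eq_mk_iff_isConj.1 (hout (ConjClasses.mk (e (t : (((cmDatum L 2 (Matrix.of fun i j : Fin 2 => if i.val + j.val + 1 = 2 then (1 : L) else 0)).Local v) × ((cmDatum L 1 (Matrix.of fun i j : Fin 1 => if i.val + j.val + 1 = 1 then (1 : L) else 0)).Local v)))))).symm))
  have hmem := (Set.ext_iff.1 hset (ConjClasses.mk (e (t : (((cmDatum L 2 (Matrix.of fun i j : Fin 2 => if i.val + j.val + 1 = 2 then (1 : L) else 0)).Local v) × ((cmDatum L 1 (Matrix.of fun i j : Fin 1 => if i.val + j.val + 1 = 1 then (1 : L) else 0)).Local v)))))).1 hst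
  rcases hmem with h1 | h1
  · exact absurd h1.symm hne'
  · have h1' : ConjClasses.mk (e (t : (((cmDatum L 2 (Matrix.of fun i j : Fin 2 => if i.val + j.val + 1 = 2 then (1 : L) else 0)).Local v) × ((cmDatum L 1 (Matrix.of fun i j : Fin 1 => if i.val + j.val + 1 = 1 then (1 : L) else 0)).Local v)))) = d' := h1
    rw [← h1'] at hset
    exact ⟨hne', hset⟩

/-- **THE CLOSED FORM OF THE κ-COMBINATION: `2Φ(⟦t⟧, f; m) − Σᶠ_{d ∼_st t} Φ(d, f; m) = Φ(⟦t⟧, f; m) − Φ(⟦t⟧, f ∘ e; m)`** for EVERY `f : H_v → ℂ` — `m` canonical for `(Reg, ν)` (`Reg`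
conjugation- and stably closed), `e : H_v ≃ₜ* H_v` preserving `ν` with `e t` stably conjugate and not conjugate to `t`, `t ∈ Z(t₀)` elliptic regular with `Reg t`.  Labesse–Langlands'
`φ^T(γ, f) = φ(γ, f) − φ(γ, f^h)` [LL §2 p. 9] in Rogawski's canonical normalisation. [cite: LabesseLanglands1979, §2 pp. 8–10] [cite: Rogawski1990, §4.3 (4.3.1) p. 43; §4.9 Lemma 4.9.3 (4.9.2) p. 56] -/
theorem two_mul_classOrbitalIntegral_sub_finsum_eq_sub (w : PlacesOver L v) (hw : IsCMField.complexConj L • w.1 = w.1)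
    {m : OrbitalMeasureFamily (((cmDatum L 2 (Matrix.of fun i j : Fin 2 => if i.val + j.val + 1 = 2 then (1 : L) else 0)).Local v) × ((cmDatum L 1 (Matrix.of fun i j : Fin 1 => if i.val + j.val + 1 = 1 then (1 : L) else 0)).Local v))} {Reg : (((cmDatum L 2 (Matrix.of fun i j : Fin 2 => if i.val + j.val + 1 = 2 then (1 : L) else 0)).Local v) × ((cmDatum L 1 (Matrix.of fun i j : Fin 1 => if i.val + j.val + 1 = 1 then (1 : L) else 0)).Local v)) → Prop}
    (hconj : ∀ γ x, Reg γ → Reg (x * γ * x⁻¹)) (hstab : ∀ γ δ, Reg γ → IsLocalStablyConjH L v γ δ → Reg δ) (hm : m.IsCanonical Reg ν)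
    (e : (((cmDatum L 2 (Matrix.of fun i j : Fin 2 => if i.val + j.val + 1 = 2 then (1 : L) else 0)).Local v) × ((cmDatum L 1 (Matrix.of fun i j : Fin 1 => if i.val + j.val + 1 = 1 then (1 : L) else 0)).Local v)) ≃ₜ* (((cmDatum L 2 (Matrix.of fun i j : Fin 2 => if i.val + j.val + 1 = 2 then (1 : L) else 0)).Local v) × ((cmDatum L 1 (Matrix.of fun i j : Fin 1 => if i.val + j.val + 1 = 1 then (1 : L) else 0)).Local v))) (he : MeasurePreserving e ν ν)
    (t₀ : (((cmDatum L 2 (Matrix.of fun i j : Fin 2 => if i.val + j.val + 1 = 2 then (1 : L) else 0)).Local v) × ((cmDatum L 1 (Matrix.of fun i j : Fin 1 => if i.val + j.val + 1 = 1 then (1 : L) else 0)).Local v))) (P : GL (Fin 2) (LocalRing L v)) (d : Fin 2 → LocalRing L v) (ht₀ : IsRegularElt (t₀.1.val : GL (Fin 2) (LocalRing L v)))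
    (hP : (t₀.1.val.val : Matrix (Fin 2) (Fin 2) (LocalRing L v)) * P.val = P.val * Matrix.diagonal d) (hd1 : ∀ i, (conjLocal L (IsCMField.complexConj L) v) (d i) * d i = 1)
    (t : ↥(Subgroup.centralizer ({t₀} : Set (((cmDatum L 2 (Matrix.of fun i j : Fin 2 => if i.val + j.val + 1 = 2 then (1 : L) else 0)).Local v) × ((cmDatum L 1 (Matrix.of fun i j : Fin 1 => if i.val + j.val + 1 = 1 then (1 : L) else 0)).Local v))))) (ht : IsRegularElt ((t : (((cmDatum L 2 (Matrix.of fun i j : Fin 2 => if i.val + j.val + 1 = 2 then (1 : L) else 0)).Local v) × ((cmDatum L 1 (Matrix.of fun i j : Fin 1 => if i.val + j.val + 1 = 1 then (1 : L) else 0)).Local v))).1.val : GL (Fin 2) (LocalRing L v))) (hRt : Reg (t : (((cmDatum L 2 (Matrix.of fun i j : Fin 2 => if i.val + j.val + 1 = 2 then (1 : L) else 0)).Local v) × ((cmDatum L 1 (Matrix.of fun i j : Fin 1 => if i.val + j.val + 1 = 1 then (1 : L) else 0)).Local v))))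
    (hest : IsLocalStablyConjH L v (t : (((cmDatum L 2 (Matrix.of fun i j : Fin 2 => if i.val + j.val + 1 = 2 then (1 : L) else 0)).Local v) × ((cmDatum L 1 (Matrix.of fun i j : Fin 1 => if i.val + j.val + 1 = 1 then (1 : L) else 0)).Local v))) (e (t : (((cmDatum L 2 (Matrix.of fun i j : Fin 2 => if i.val + j.val + 1 = 2 then (1 : L) else 0)).Local v) × ((cmDatum L 1 (Matrix.of fun i j : Fin 1 => if i.val + j.val + 1 = 1 then (1 : L) else 0)).Local v)))) ∧ ¬ IsConj (t : (((cmDatum L 2 (Matrix.of fun i j : Fin 2 => if i.val + j.val + 1 = 2 then (1 : L) else 0)).Local v) × ((cmDatum L 1 (Matrix.of fun i j : Fin 1 => if i.val + j.val + 1 = 1 then (1 : L) else 0)).Local v))) (e (t : (((cmDatum L 2 (Matrix.of fun i j : Fin 2 => if i.val + j.val + 1 = 2 then (1 : L) else 0)).Local v) × ((cmDatum L 1 (Matrix.of fun i j : Fin 1 => if i.val + j.val + 1 = 1 then (1 : L) else 0)).Local v))))) (f : (((cmDatum L 2 (Matrix.of fun i j : Fin 2 => if i.val + j.val + 1 = 2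 then (1 : L) else 0)).Local v) × ((cmDatum L 1 (Matrix.of fun i j : Fin 1 => if i.val + j.val + 1 = 1 then (1 : L) else 0)).Local v)) → ℂ) :
    2 * classOrbitalIntegral m f (ConjClasses.mk (t : (((cmDatum L 2 (Matrix.of fun i j : Fin 2 => if i.val + j.val + 1 = 2 then (1 : L) else 0)).Local v) × ((cmDatum L 1 (Matrix.of fun i j : Fin 1 => if i.val + j.val + 1 = 1 then (1 : L) else 0)).Local v)))) -
        ∑ᶠ c ∈ {c : ConjClasses (((cmDatum L 2 (Matrix.of fun i j : Fin 2 => if i.val + j.val + 1 = 2 then (1 : L) else 0)).Local v) × ((cmDatum L 1 (Matrix.of fun i j : Fin 1 => if i.val + j.val + 1 = 1 then (1 : L) else 0)).Local v)) | IsLocalStablyConjH L v (t : (((cmDatum L 2 (Matrix.of fun i j : Fin 2 => if i.val + j.val + 1 = 2 then (1 : L) else 0)).Local v) × ((cmDatum L 1 (Matrix.of fun i j : Fin 1 => if i.val + j.val + 1 = 1 then (1 : L) else 0)).Local v))) (Quotient.out c)}, classOrbitalIntegral m f c =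
      classOrbitalIntegral m f (ConjClasses.mk (t : (((cmDatum L 2 (Matrix.of fun i j : Fin 2 => if i.val + j.val + 1 = 2 then (1 : L) else 0)).Local v) × ((cmDatum L 1 (Matrix.of fun i j : Fin 1 => if i.val + j.val + 1 = 1 then (1 : L) else 0)).Local v)))) - classOrbitalIntegral m (f ∘ e) (ConjClasses.mk (t : (((cmDatum L 2 (Matrix.of fun i j : Fin 2 => if i.val + j.val + 1 = 2 then (1 : L) else 0)).Local v) × ((cmDatum L 1 (Matrix.of fun i j : Fin 1 => if i.val + j.val + 1 = 1 then (1 : L) else 0)).Local v)))) := by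
  obtain ⟨hne, hset⟩ := setOf_isLocalStablyConjH_out_eq_pair_congr L v w hw e t₀ P d ht₀ hP hd1 t ht hest
  rw [hset, finsum_mem_pair hne, classOrbitalIntegral_mk_congr_eq_comp L v ν hconj hstab hm e he (t : (((cmDatum L 2 (Matrix.of fun i j : Fin 2 => if i.val + j.val + 1 = 2 then (1 : L) else 0)).Local v) × ((cmDatum L 1 (Matrix.of fun i j : Fin 1 => if i.val + j.val + 1 = 1 then (1 : L) else 0)).Local v))) hRt hest.1 f]
  ring

/-- **`Φ^κ(t, f; m) = 0` FOR `e`-INVARIANT `f`**: with the data of `two_mul_classOrbitalIntegral_sub_finsum_eq_sub` and `f ∘ e = f`,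
`2Φ(⟦t⟧, f; m) − Σᶠ_{d ∼_st t} Φ(d, f; m) = 0`. [cite: LabesseLanglands1979, §2 pp. 9–10] [cite: Rogawski1990, §4.9 Lemma 4.9.3 (4.9.2) p. 56] -/
theorem two_mul_classOrbitalIntegral_sub_finsum_eq_zero_of_comp_eq (w : PlacesOver L v) (hw : IsCMField.complexConj L • w.1 = w.1)
    {m : OrbitalMeasureFamily (((cmDatum L 2 (Matrix.of fun i j : Fin 2 => if i.val + j.val + 1 = 2 then (1 : L) else 0)).Local v) × ((cmDatum L 1 (Matrix.of fun i j : Fin 1 => if i.val + j.val + 1 = 1 then (1 : L) else 0)).Local v))} {Reg : (((cmDatum L 2 (Matrix.of fun i j : Fin 2 => if i.val + j.val + 1 = 2 then (1 : L) else 0)).Local v) × ((cmDatum L 1 (Matrix.of fun i j : Fin 1 => if i.val + j.val + 1 = 1 then (1 : L) else 0)).Local v)) → Prop}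
    (hconj : ∀ γ x, Reg γ → Reg (x * γ * x⁻¹)) (hstab : ∀ γ δ, Reg γ → IsLocalStablyConjH L v γ δ → Reg δ) (hm : m.IsCanonical Reg ν)
    (e : (((cmDatum L 2 (Matrix.of fun i j : Fin 2 => if i.val + j.val + 1 = 2 then (1 : L) else 0)).Local v) × ((cmDatum L 1 (Matrix.of fun i j : Fin 1 => if i.val + j.val + 1 = 1 then (1 : L) else 0)).Local v)) ≃ₜ* (((cmDatum L 2 (Matrix.of fun i j : Fin 2 => if i.val + j.val + 1 = 2 then (1 : L) else 0)).Local v) × ((cmDatum L 1 (Matrix.of fun i j : Fin 1 => if i.val + j.val + 1 = 1 then (1 : L) else 0)).Local v))) (he : MeasurePreserving e ν ν) (f : (((cmDatum L 2 (Matrix.of fun i j : Fin 2 => if i.val + j.val + 1 = 2 then (1 : L) else 0)).Local v) × ((cmDatum L 1 (Matrix.of fun i j : Fin 1 => if i.val + j.val + 1 = 1 then (1 : L) else 0)).Local v)) → ℂ) (hfix : f ∘ e = f)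
    (t₀ : (((cmDatum L 2 (Matrix.of fun i j : Fin 2 => if i.val + j.val + 1 = 2 then (1 : L) else 0)).Local v) × ((cmDatum L 1 (Matrix.of fun i j : Fin 1 => if i.val + j.val + 1 = 1 then (1 : L) else 0)).Local v))) (P : GL (Fin 2) (LocalRing L v)) (d : Fin 2 → LocalRing L v) (ht₀ : IsRegularElt (t₀.1.val : GL (Fin 2) (LocalRing L v)))
    (hP : (t₀.1.val.val : Matrix (Fin 2) (Fin 2) (LocalRing L v)) * P.val = P.val * Matrix.diagonal d) (hd1 : ∀ i, (conjLocal L (IsCMField.complexConj L) v) (d i) * d i = 1)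
    (t : ↥(Subgroup.centralizer ({t₀} : Set (((cmDatum L 2 (Matrix.of fun i j : Fin 2 => if i.val + j.val + 1 = 2 then (1 : L) else 0)).Local v) × ((cmDatum L 1 (Matrix.of fun i j : Fin 1 => if i.val + j.val + 1 = 1 then (1 : L) else 0)).Local v))))) (ht : IsRegularElt ((t : (((cmDatum L 2 (Matrix.of fun i j : Fin 2 => if i.val + j.val + 1 = 2 then (1 : L) else 0)).Local v) × ((cmDatum L 1 (Matrix.of fun i j : Fin 1 => if i.val + j.val + 1 = 1 then (1 : L) else 0)).Local v))).1.val : GL (Fin 2) (LocalRing L v))) (hRt : Reg (t : (((cmDatum L 2 (Matrix.of fun i j : Fin 2 => if i.val + j.val + 1 = 2 then (1 : L) else 0)).Local v) × ((cmDatum L 1 (Matrix.of fun i j : Fin 1 => if i.val + j.val + 1 = 1 then (1 : L) else 0)).Local v))))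
    (hest : IsLocalStablyConjH L v (t : (((cmDatum L 2 (Matrix.of fun i j : Fin 2 => if i.val + j.val + 1 = 2 then (1 : L) else 0)).Local v) × ((cmDatum L 1 (Matrix.of fun i j : Fin 1 => if i.val + j.val + 1 = 1 then (1 : L) else 0)).Local v))) (e (t : (((cmDatum L 2 (Matrix.of fun i j : Fin 2 => if i.val + j.val + 1 = 2 then (1 : L) else 0)).Local v) × ((cmDatum L 1 (Matrix.of fun i j : Fin 1 => if i.val + j.val + 1 = 1 then (1 : L) else 0)).Local v)))) ∧ ¬ IsConj (t : (((cmDatum L 2 (Matrix.of fun i j : Fin 2 => if i.val + j.val + 1 = 2 then (1 : L) else 0)).Local v) × ((cmDatum L 1 (Matrix.of fun i j : Fin 1 => if i.val + j.val + 1 = 1 then (1 : L) else 0)).Local v))) (e (t : (((cmDatum L 2 (Matrix.of fun i j : Fin 2 => if i.val + j.val + 1 = 2 then (1 : L) else 0)).Local v) × ((cmDatum L 1 (Matrix.of fun i j : Fin 1 => if i.val + j.val + 1 = 1 then (1 : L) else 0)).Local v))))) :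
    2 * classOrbitalIntegral m f (ConjClasses.mk (t : (((cmDatum L 2 (Matrix.of fun i j : Fin 2 => if i.val + j.val + 1 = 2 then (1 : L) else 0)).Local v) × ((cmDatum L 1 (Matrix.of fun i j : Fin 1 => if i.val + j.val + 1 = 1 then (1 : L) else 0)).Local v)))) -
        ∑ᶠ c ∈ {c : ConjClasses (((cmDatum L 2 (Matrix.of fun i j : Fin 2 => if i.val + j.val + 1 = 2 then (1 : L) else 0)).Local v) × ((cmDatum L 1 (Matrix.of fun i j : Fin 1 => if i.val + j.val + 1 = 1 then (1 : L) else 0)).Local v)) | IsLocalStablyConjH L v (t : (((cmDatum L 2 (Matrix.of fun i j : Fin 2 => if i.val + j.val + 1 = 2 then (1 : L) else 0)).Local v) × ((cmDatum L 1 (Matrix.of fun i j : Fin 1 => if i.val + j.val + 1 = 1 then (1 : L) else 0)).Local v))) (Quotient.out c)}, classOrbitalIntegral m f c = 0 := by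
  rw [two_mul_classOrbitalIntegral_sub_finsum_eq_sub L v ν w hw hconj hstab hm e he t₀ P d ht₀ hP hd1 t ht hRt hest f, hfix, sub_self]

end Letter

/-! ## §2 THE RAMIFIED UNIT ROW in the letter's tokens: `Δ(t)·(2Φ(⟦t⟧, 𝟙_{K_H}; m) − Σᶠ_{st} Φ(·, 𝟙_{K_H}; m)) = 0` -/

section Ramified

variable (L : Type) [Field L] [NumberField L] [IsCMField L] (v : HeightOneSpectrum (𝓞 ↥(maximalRealSubfield L)))
  [MeasurableSpace (((cmDatum L 2 (Matrix.of fun i j : Fin 2 => if i.val + j.val + 1 = 2 then (1 : L) else 0)).Local v) × ((cmDatum L 1 (Matrix.of fun i j : Fin 1 => if i.val + j.val + 1 = 1 then (1 : L) else 0)).Local v))] [BorelSpace (((cmDatum L 2 (Matrix.of fun i j : Fin 2 => if i.val + j.val + 1 = 2 then (1 : L) else 0)).Local v) × ((cmDatum L 1 (Matrix.of fun i j : Fin 1 => if i.val + j.val + 1 = 1 then (1 : L) else 0)).Local v))] (ν : Measure (((cmDatum L 2 (Matrix.of fun i j : Fin 2 => if i.val + j.val + 1 = 2 then (1 : L) else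 0)).Local v) × ((cmDatum L 1 (Matrix.of fun i j : Fin 1 => if i.val + j.val + 1 = 1 then (1 : L) else 0)).Local v))) [ν.IsHaarMeasure] [ν.IsMulRightInvariant]
  [iZ : ∀ γ : (((cmDatum L 2 (Matrix.of fun i j : Fin 2 => if i.val + j.val + 1 = 2 then (1 : L) else 0)).Local v) × ((cmDatum L 1 (Matrix.of fun i j : Fin 1 => if i.val + j.val + 1 = 1 then (1 : L) else 0)).Local v)), MeasurableSpace ((((cmDatum L 2 (Matrix.of fun i j : Fin 2 => if i.val + j.val + 1 = 2 then (1 : L) else 0)).Local v) × ((cmDatum L 1 (Matrix.of fun i j : Fin 1 => if i.val + j.val + 1 = 1 then (1 : L) else 0)).Local v)) ⧸ Subgroup.centralizer ({γ} : Set (((cmDatum L 2 (Matrix.of fun i j : Fin 2 => if i.val + j.val + 1 = 2 then (1 : L) else 0)).Local v) × ((cmDatum L 1 (Matrix.of fun i j : Fin 1 => if i.val + j.val + 1 = 1 then (1 : L) else 0)).Local v))))]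
  [bZ : ∀ γ : (((cmDatum L 2 (Matrix.of fun i j : Fin 2 => if i.val + j.val + 1 = 2 then (1 : L) else 0)).Local v) × ((cmDatum L 1 (Matrix.of fun i j : Fin 1 => if i.val + j.val + 1 = 1 then (1 : L) else 0)).Local v)), BorelSpace ((((cmDatum L 2 (Matrix.of fun i j : Fin 2 => if i.val + j.val + 1 = 2 then (1 : L) else 0)).Local v) × ((cmDatum L 1 (Matrix.of fun i j : Fin 1 => if i.val + j.val + 1 = 1 then (1 : L) else 0)).Local v)) ⧸ Subgroup.centralizer ({γ} : Set (((cmDatum L 2 (Matrix.of fun i j : Fin 2 => if i.val + j.val + 1 = 2 then (1 : L) else 0)).Local v) × ((cmDatum L 1 (Matrix.of fun i j : Fin 1 => if i.val + j.val + 1 = 1 then (1 : L) else 0)).Local v))))]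

/-- **THE RAMIFIED UNIT ROW, LETTER LEVEL (`(w hw he)` binders).**  `L` CM; `v` a finite place of `L⁺` with a conjugation-fixed place `w ∣ v` RAMIFIED in `L ∕ L⁺` (`e(w|v) ≠ 1`); `ν` a two-sided
Haar measure of `H_v = U(Φ₂)(L⁺_v) × U(Φ₁)(L⁺_v)`; `Reg` any conjugation- and stably-closed sub-predicate of «`U(Φ₂)`-part regular» and `m` a family CANONICAL for `(Reg, ν)` (the letter's data);
`μ` any Hecke character; `C = Z(t₀)` an elliptic torus (`t₀,₁` regular, eigenframe `(P, d)` over `L ⊗ L⁺_v` with norm-one eigenvalues); `K_H = U(Φ₂)(𝒪_v) ×ˢ U(Φ₁)(𝒪_v)`.  Then for every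
`t ∈ Z(t₀)` with `Reg t`: **`μ_w(γ₁(t) − γ₃(t))⁻¹ · (∏_{w'} ‖γ₁(t) − γ₃(t)‖_{w'})^{1∕2} · (2Φ(⟦t⟧, 𝟙_{K_H}; m) − Σᶠ_{d ∼_st t} Φ(d, 𝟙_{K_H}; m)) = 0`** — «it is clear that
`φ^T(γ, f) = 0` if `L` is ramified» [LL p. 9–10] (the partner `e = (Ad diag(1, r), id)` of ★ `exists_unitSimilitudePartner_of_ramified` fixes `K_H` and every Haar measure; §1).  Compare the
INERT certificate ★ `rankOne_lhs_indicator_eq_of_eigenframe_of_guard`: there the same left side is `μ_v(u₁)⁻¹ C⁻¹ (−1)^e ≠ 0`.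
[cite: LabesseLanglands1979, §2 pp. 9–10] [cite: Rogawski1990, §4.9 Lemma 4.9.3 (4.9.2) p. 56; Prop. 4.9.1 (b) p. 55; §4.3 (4.3.1) p. 43] -/
theorem rankOne_letter_lhs_indicator_eq_zero_of_ramified (w : PlacesOver L v) (hw : IsCMField.complexConj L • w.1 = w.1)
    (he : v.asIdeal.ramificationIdx' w.1.asIdeal ≠ 1) (μ : HeckeCharacter L)
    {m : OrbitalMeasureFamily (((cmDatum L 2 (Matrix.of fun i j : Fin 2 => if i.val + j.val + 1 = 2 then (1 : L) else 0)).Local v) × ((cmDatum L 1 (Matrix.of fun i j : Fin 1 => if i.val + j.val + 1 = 1 then (1 : L) else 0)).Local v))} {Reg : (((cmDatum L 2 (Matrix.of fun i j : Fin 2 => if i.val + j.val + 1 = 2 then (1 : L) else 0)).Local v) × ((cmDatum L 1 (Matrix.of fun i j : Fin 1 => if i.val + j.val + 1 = 1 then (1 : L) else 0)).Local v)) → Prop} (hReg : ∀ γ, Reg γ → IsRegularElt (γ.1.val : GL (Fin 2) (LocalRing L v)))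
    (hconj : ∀ γ x, Reg γ → Reg (x * γ * x⁻¹)) (hstab : ∀ γ δ, Reg γ → IsLocalStablyConjH L v γ δ → Reg δ) (hm : m.IsCanonical Reg ν)
    (t₀ : (((cmDatum L 2 (Matrix.of fun i j : Fin 2 => if i.val + j.val + 1 = 2 then (1 : L) else 0)).Local v) × ((cmDatum L 1 (Matrix.of fun i j : Fin 1 => if i.val + j.val + 1 = 1 then (1 : L) else 0)).Local v))) (P : GL (Fin 2) (LocalRing L v)) (d : Fin 2 → LocalRing L v) (ht₀ : IsRegularElt (t₀.1.val : GL (Fin 2) (LocalRing L v)))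
    (hP : (t₀.1.val.val : Matrix (Fin 2) (Fin 2) (LocalRing L v)) * P.val = P.val * Matrix.diagonal d) (hd1 : ∀ i, (conjLocal L (IsCMField.complexConj L) v) (d i) * d i = 1)
    (t : ↥(Subgroup.centralizer ({t₀} : Set (((cmDatum L 2 (Matrix.of fun i j : Fin 2 => if i.val + j.val + 1 = 2 then (1 : L) else 0)).Local v) × ((cmDatum L 1 (Matrix.of fun i j : Fin 1 => if i.val + j.val + 1 = 1 then (1 : L) else 0)).Local v))))) (hRt : Reg (t : (((cmDatum L 2 (Matrix.of fun i j : Fin 2 => if i.val + j.val + 1 = 2 then (1 : L) else 0)).Local v) × ((cmDatum L 1 (Matrix.of fun i j : Fin 1 => if i.val + j.val + 1 = 1 then (1 : L) else 0)).Local v)))) :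
    ((finHeckeValue L v μ (((P⁻¹).val * ((t : (((cmDatum L 2 (Matrix.of fun i j : Fin 2 => if i.val + j.val + 1 = 2 then (1 : L) else 0)).Local v) × ((cmDatum L 1 (Matrix.of fun i j : Fin 1 => if i.val + j.val + 1 = 1 then (1 : L) else 0)).Local v))).1.val.val : Matrix (Fin 2) (Fin 2) (LocalRing L v)) * P.val) 0 0 - ((P⁻¹).val * ((t : (((cmDatum L 2 (Matrix.of fun i j : Fin 2 => if i.val + j.val + 1 = 2 then (1 : L) else 0)).Local v) × ((cmDatum L 1 (Matrix.of fun i j : Fin 1 => if i.val + j.val + 1 = 1 then (1 : L) else 0)).Local v))).1.val.val : Matrix (Fin 2) (Fin 2) (LocalRing L v)) * P.val) 1 1))⁻¹ : ℂ) *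
        ((Real.sqrt (∏ w' : PlacesOver L v, ‖(((P⁻¹).val * ((t : (((cmDatum L 2 (Matrix.of fun i j : Fin 2 => if i.val + j.val + 1 = 2 then (1 : L) else 0)).Local v) × ((cmDatum L 1 (Matrix.of fun i j : Fin 1 => if i.val + j.val + 1 = 1 then (1 : L) else 0)).Local v))).1.val.val : Matrix (Fin 2) (Fin 2) (LocalRing L v)) * P.val) 0 0 - ((P⁻¹).val * ((t : (((cmDatum L 2 (Matrix.of fun i j : Fin 2 => if i.val + j.val + 1 = 2 then (1 : L) else 0)).Local v) × ((cmDatum L 1 (Matrix.of fun i j : Fin 1 => if i.val + j.val + 1 = 1 then (1 : L) else 0)).Local v))).1.val.val : Matrix (Fin 2) (Fin 2) (LocalRing L v)) * P.val) 1 1) w'‖) : ℝ) : ℂ) *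
        (2 * classOrbitalIntegral m ((((cmLocalIntegralLevel L 2 (Matrix.of fun i j : Fin 2 => if i.val + j.val + 1 = 2 then (1 : L) else 0) v).prod (cmLocalIntegralLevel L 1 (Matrix.of fun i j : Fin 1 => if i.val + j.val + 1 = 1 then (1 : L) else 0) v) : Subgroup (((cmDatum L 2 (Matrix.of fun i j : Fin 2 => if i.val + j.val + 1 = 2 then (1 : L) else 0)).Local v) × ((cmDatum L 1 (Matrix.of fun i j : Fin 1 => if i.val + j.val + 1 = 1 then (1 : L) else 0)).Local v))) : Set (((cmDatum L 2 (Matrix.of fun i j : Fin 2 => if i.val + j.val + 1 = 2 then (1 : L) else 0)).Local v) × ((cmDatum L 1 (Matrix.of fun i j : Fin 1 => if i.val + j.val + 1 = 1 then (1 : L) else 0)).Local v))).indicator fun _ => (1 : ℂ))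
              (ConjClasses.mk (t : (((cmDatum L 2 (Matrix.of fun i j : Fin 2 => if i.val + j.val + 1 = 2 then (1 : L) else 0)).Local v) × ((cmDatum L 1 (Matrix.of fun i j : Fin 1 => if i.val + j.val + 1 = 1 then (1 : L) else 0)).Local v)))) -
          ∑ᶠ c ∈ {c : ConjClasses (((cmDatum L 2 (Matrix.of fun i j : Fin 2 => if i.val + j.val + 1 = 2 then (1 : L) else 0)).Local v) × ((cmDatum L 1 (Matrix.of fun i j : Fin 1 => if i.val + j.val + 1 = 1 then (1 : L) else 0)).Local v)) | IsLocalStablyConjH L v (t : (((cmDatum L 2 (Matrix.of fun i j : Fin 2 => if i.val + j.val + 1 = 2 then (1 : L) else 0)).Local v) × ((cmDatum L 1 (Matrix.of fun i j : Fin 1 => if i.val + j.val + 1 = 1 then (1 : L) else 0)).Local v))) (Quotient.out c)},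
            classOrbitalIntegral m ((((cmLocalIntegralLevel L 2 (Matrix.of fun i j : Fin 2 => if i.val + j.val + 1 = 2 then (1 : L) else 0) v).prod (cmLocalIntegralLevel L 1 (Matrix.of fun i j : Fin 1 => if i.val + j.val + 1 = 1 then (1 : L) else 0) v) : Subgroup (((cmDatum L 2 (Matrix.of fun i j : Fin 2 => if i.val + j.val + 1 = 2 then (1 : L) else 0)).Local v) × ((cmDatum L 1 (Matrix.of fun i j : Fin 1 => if i.val + j.val + 1 = 1 then (1 : L) else 0)).Local v))) : Set (((cmDatum L 2 (Matrix.of fun i j : Fin 2 => if i.val + j.val + 1 = 2 then (1 : L) else 0)).Local v) × ((cmDatum L 1 (Matrix.of fun i j : Fin 1 => if i.val + j.val + 1 = 1 then (1 : L) else 0)).Local v))).indicator fun _ => (1 : ℂ)) c) = 0 := by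
  obtain ⟨r, hru, e, -, -, -, -, -, hest, hK, hν⟩ := exists_unitSimilitudePartner_of_ramified L v w hw he t₀ P d ht₀ hP hd1
  have hfix : ((((cmLocalIntegralLevel L 2 (Matrix.of fun i j : Fin 2 => if i.val + j.val + 1 = 2 then (1 : L) else 0) v).prod (cmLocalIntegralLevel L 1 (Matrix.of fun i j : Fin 1 => if i.val + j.val + 1 = 1 then (1 : L) else 0) v) : Subgroup (((cmDatum L 2 (Matrix.of fun i j : Fin 2 => if i.val + j.val + 1 = 2 then (1 : L) else 0)).Local v) × ((cmDatum L 1 (Matrix.of fun i j : Fin 1 => if i.val + j.val + 1 = 1 then (1 : L) else 0)).Local v))) : Set (((cmDatum L 2 (Matrix.of fun i j : Fin 2 => if i.val + j.val + 1 = 2 then (1 : L) else 0)).Local v) × ((cmDatum L 1 (Matrix.of fun i j : Fin 1 => if i.val + j.val + 1 = 1 then (1 : L) else 0)).Local v))).indicator (fun _ => (1 : ℂ))) ∘ e =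
      (((cmLocalIntegralLevel L 2 (Matrix.of fun i j : Fin 2 => if i.val + j.val + 1 = 2 then (1 : L) else 0) v).prod (cmLocalIntegralLevel L 1 (Matrix.of fun i j : Fin 1 => if i.val + j.val + 1 = 1 then (1 : L) else 0) v) : Subgroup (((cmDatum L 2 (Matrix.of fun i j : Fin 2 => if i.val + j.val + 1 = 2 then (1 : L) else 0)).Local v) × ((cmDatum L 1 (Matrix.of fun i j : Fin 1 => if i.val + j.val + 1 = 1 then (1 : L) else 0)).Local v))) : Set (((cmDatum L 2 (Matrix.of fun i j : Fin 2 => if i.val + j.val + 1 = 2 then (1 : L) else 0)).Local v) × ((cmDatum L 1 (Matrix.of fun i j : Fin 1 => if i.val + j.val + 1 = 1 then (1 : L) else 0)).Local v))).indicator (fun _ => (1 : ℂ)) := by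
    funext a
    simp only [Function.comp_apply]
    by_cases ha : a ∈ ((cmLocalIntegralLevel L 2 (Matrix.of fun i j : Fin 2 => if i.val + j.val + 1 = 2 then (1 : L) else 0) v).prod (cmLocalIntegralLevel L 1 (Matrix.of fun i j : Fin 1 => if i.val + j.val + 1 = 1 then (1 : L) else 0) v) : Subgroup (((cmDatum L 2 (Matrix.of fun i j : Fin 2 => if i.val + j.val + 1 = 2 then (1 : L) else 0)).Local v) × ((cmDatum L 1 (Matrix.of fun i j : Fin 1 => if i.val + j.val + 1 = 1 then (1 : L) else 0)).Local v)))
    · rw [Set.indicator_of_mem (show e a ∈ (((cmLocalIntegralLevel L 2 (Matrix.of fun i j : Fin 2 => if i.val + j.val + 1 = 2 then (1 : L) else 0) v).prod (cmLocalIntegralLevel L 1 (Matrix.of fun i j : Fin 1 => if i.val + j.val + 1 = 1 then (1 : L) else 0) v) : Subgroup (((cmDatum L 2 (Matrix.of fun i j : Fin 2 => if i.val + j.val + 1 = 2 then (1 : L) else 0)).Local v) × ((cmDatum L 1 (Matrix.of fun i j : Fin 1 => if i.val + j.val + 1 = 1 then (1 : L) else 0)).Local v))) : Set (((cmDatum L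 2 (Matrix.of fun i j : Fin 2 => if i.val + j.val + 1 = 2 then (1 : L) else 0)).Local v) × ((cmDatum L 1 (Matrix.of fun i j : Fin 1 => if i.val + j.val + 1 = 1 then (1 : L) else 0)).Local v))) from (hK a).2 ha),
        Set.indicator_of_mem (show a ∈ (((cmLocalIntegralLevel L 2 (Matrix.of fun i j : Fin 2 => if i.val + j.val + 1 = 2 then (1 : L) else 0) v).prod (cmLocalIntegralLevel L 1 (Matrix.of fun i j : Fin 1 => if i.val + j.val + 1 = 1 then (1 : L) else 0) v) : Subgroup (((cmDatum L 2 (Matrix.of fun i j : Fin 2 => if i.val + j.val + 1 = 2 then (1 : L) else 0)).Local v) × ((cmDatum L 1 (Matrix.of fun i j : Fin 1 => if i.val + j.val + 1 = 1 then (1 : L) else 0)).Local v))) : Set (((cmDatum L 2 (Matrix.of fun i j : Fin 2 => if i.val + j.val + 1 = 2 then (1 : L) else 0)).Local v) × ((cmDatum L 1 (Matrix.of fun i j : Fin 1 => if i.val + j.val + 1 = 1 then (1 : L) else 0)).Local v))) from ha)]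
    · rw [Set.indicator_of_notMem (show e a ∉ (((cmLocalIntegralLevel L 2 (Matrix.of fun i j : Fin 2 => if i.val + j.val + 1 = 2 then (1 : L) else 0) v).prod (cmLocalIntegralLevel L 1 (Matrix.of fun i j : Fin 1 => if i.val + j.val + 1 = 1 then (1 : L) else 0) v) : Subgroup (((cmDatum L 2 (Matrix.of fun i j : Fin 2 => if i.val + j.val + 1 = 2 then (1 : L) else 0)).Local v) × ((cmDatum L 1 (Matrix.of fun i j : Fin 1 => if i.val + j.val + 1 = 1 then (1 : L) else 0)).Local v))) : Set (((cmDatum L 2 (Matrix.of fun i j : Fin 2 => if i.val + j.val + 1 = 2 then (1 : L) else 0)).Local v) × ((cmDatum L 1 (Matrix.of fun i j : Fin 1 => if i.val + j.val + 1 = 1 then (1 : L) else 0)).Local v))) from fun h => ha ((hK a).1 h)),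
        Set.indicator_of_notMem (show a ∉ (((cmLocalIntegralLevel L 2 (Matrix.of fun i j : Fin 2 => if i.val + j.val + 1 = 2 then (1 : L) else 0) v).prod (cmLocalIntegralLevel L 1 (Matrix.of fun i j : Fin 1 => if i.val + j.val + 1 = 1 then (1 : L) else 0) v) : Subgroup (((cmDatum L 2 (Matrix.of fun i j : Fin 2 => if i.val + j.val + 1 = 2 then (1 : L) else 0)).Local v) × ((cmDatum L 1 (Matrix.of fun i j : Fin 1 => if i.val + j.val + 1 = 1 then (1 : L) else 0)).Local v))) : Set (((cmDatum L 2 (Matrix.of fun i j : Fin 2 => if i.val + j.val + 1 = 2 then (1 : L) else 0)).Local v) × ((cmDatum L 1 (Matrix.of fun i j : Fin 1 => if i.val + j.val + 1 = 1 then (1 : L) else 0)).Local v))) from ha)]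
  rw [two_mul_classOrbitalIntegral_sub_finsum_eq_zero_of_comp_eq L v ν w hw hconj hstab hm e (hν ν) _ hfix t₀ P d ht₀ hP hd1 t (hReg _ hRt) hRt
    (hest t (hReg _ hRt)), mul_zero]

/-- **THE RAMIFIED UNIT ROW IN THE LETTER'S `∃ fC` DRESS (`(hv hram)` binders): the body of ★ `RankOneUnstableTransferNonsplitCMERamified` at ONE datum for `f = 𝟙_{K_H}`, closed with `fC = 0`.**
`hv : Subsingleton (PlacesOver L v)` (non-split), `hram : ¬ Algebra.IsUnramifiedIn (𝓞 L) v` (ramified; ★ `ramificationIdx'_ne_one_of_not_isUnramifiedIn`), the letter's `(Reg, m, ν)` data,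
any `μ` (the μ-guards of the letter are not needed for this row), any elliptic torus `Z(t₀)`: a locally constant, compactly supported `fC` on `Z(t₀)` (namely `0`) with
`Δ(t)·(2Φ(⟦t⟧, 𝟙_{K_H}; m) − Σᶠ_{st} Φ(·, 𝟙_{K_H}; m)) = fC t` at every `t` with `Reg t`. [cite: LabesseLanglands1979, §2 pp. 9–10] [cite: Rogawski1990, §4.9 Lemma 4.9.3 (4.9.2) p. 56] -/
theorem exists_letter_indicator_of_not_isUnramifiedIn (hv : Subsingleton (PlacesOver L v)) (hram : ¬ Algebra.IsUnramifiedIn (𝓞 L) v.asIdeal) (μ : HeckeCharacter L)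
    {m : OrbitalMeasureFamily (((cmDatum L 2 (Matrix.of fun i j : Fin 2 => if i.val + j.val + 1 = 2 then (1 : L) else 0)).Local v) × ((cmDatum L 1 (Matrix.of fun i j : Fin 1 => if i.val + j.val + 1 = 1 then (1 : L) else 0)).Local v))} {Reg : (((cmDatum L 2 (Matrix.of fun i j : Fin 2 => if i.val + j.val + 1 = 2 then (1 : L) else 0)).Local v) × ((cmDatum L 1 (Matrix.of fun i j : Fin 1 => if i.val + j.val + 1 = 1 then (1 : L) else 0)).Local v)) → Prop} (hReg : ∀ γ, Reg γ → IsRegularElt (γ.1.val : GL (Fin 2) (LocalRing L v)))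
    (hconj : ∀ γ x, Reg γ → Reg (x * γ * x⁻¹)) (hstab : ∀ γ δ, Reg γ → IsLocalStablyConjH L v γ δ → Reg δ) (hm : m.IsCanonical Reg ν)
    (t₀ : (((cmDatum L 2 (Matrix.of fun i j : Fin 2 => if i.val + j.val + 1 = 2 then (1 : L) else 0)).Local v) × ((cmDatum L 1 (Matrix.of fun i j : Fin 1 => if i.val + j.val + 1 = 1 then (1 : L) else 0)).Local v))) (P : GL (Fin 2) (LocalRing L v)) (d : Fin 2 → LocalRing L v) (ht₀ : IsRegularElt (t₀.1.val : GL (Fin 2) (LocalRing L v)))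
    (hP : (t₀.1.val.val : Matrix (Fin 2) (Fin 2) (LocalRing L v)) * P.val = P.val * Matrix.diagonal d) (hd1 : ∀ i, (conjLocal L (IsCMField.complexConj L) v) (d i) * d i = 1) :
    ∃ fC : ↥(Subgroup.centralizer ({t₀} : Set (((cmDatum L 2 (Matrix.of fun i j : Fin 2 => if i.val + j.val + 1 = 2 then (1 : L) else 0)).Local v) × ((cmDatum L 1 (Matrix.of fun i j : Fin 1 => if i.val + j.val + 1 = 1 then (1 : L) else 0)).Local v)))) → ℂ, IsLocallyConstant fC ∧ HasCompactSupport fC ∧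
      ∀ t : ↥(Subgroup.centralizer ({t₀} : Set (((cmDatum L 2 (Matrix.of fun i j : Fin 2 => if i.val + j.val + 1 = 2 then (1 : L) else 0)).Local v) × ((cmDatum L 1 (Matrix.of fun i j : Fin 1 => if i.val + j.val + 1 = 1 then (1 : L) else 0)).Local v)))), Reg (t : (((cmDatum L 2 (Matrix.of fun i j : Fin 2 => if i.val + j.val + 1 = 2 then (1 : L) else 0)).Local v) × ((cmDatum L 1 (Matrix.of fun i j : Fin 1 => if i.val + j.val + 1 = 1 then (1 : L) else 0)).Local v))) →
        ((finHeckeValue L v μ (((P⁻¹).val * ((t : (((cmDatum L 2 (Matrix.of fun i j : Fin 2 => if i.val + j.val + 1 = 2 then (1 : L) else 0)).Local v) × ((cmDatum L 1 (Matrix.of fun i j : Fin 1 => if i.val + j.val + 1 = 1 then (1 : L) else 0)).Local v))).1.val.val : Matrix (Fin 2) (Fin 2) (LocalRing L v)) * P.val) 0 0 - ((P⁻¹).val * ((t : (((cmDatum L 2 (Matrix.of fun i j : Fin 2 => if i.val + j.val + 1 = 2 then (1 : L) else 0)).Local v) × ((cmDatum L 1 (Matrix.of fun i j : Fin 1 =>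 if i.val + j.val + 1 = 1 then (1 : L) else 0)).Local v))).1.val.val : Matrix (Fin 2) (Fin 2) (LocalRing L v)) * P.val) 1 1))⁻¹ : ℂ) *
            ((Real.sqrt (∏ w' : PlacesOver L v, ‖(((P⁻¹).val * ((t : (((cmDatum L 2 (Matrix.of fun i j : Fin 2 => if i.val + j.val + 1 = 2 then (1 : L) else 0)).Local v) × ((cmDatum L 1 (Matrix.of fun i j : Fin 1 => if i.val + j.val + 1 = 1 then (1 : L) else 0)).Local v))).1.val.val : Matrix (Fin 2) (Fin 2) (LocalRing L v)) * P.val) 0 0 - ((P⁻¹).val * ((t : (((cmDatum L 2 (Matrix.of fun i j : Fin 2 => if i.val + j.val + 1 = 2 then (1 : L) else 0)).Local v) × ((cmDatum L 1 (Matrix.of fun i j : Fin 1 => if i.val + j.val + 1 = 1 then (1 : L) else 0)).Local v))).1.val.val : Matrix (Fin 2) (Fin 2) (LocalRing L v)) * P.val) 1 1) w'‖) : ℝ) : ℂ) *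
            (2 * classOrbitalIntegral m ((((cmLocalIntegralLevel L 2 (Matrix.of fun i j : Fin 2 => if i.val + j.val + 1 = 2 then (1 : L) else 0) v).prod (cmLocalIntegralLevel L 1 (Matrix.of fun i j : Fin 1 => if i.val + j.val + 1 = 1 then (1 : L) else 0) v) : Subgroup (((cmDatum L 2 (Matrix.of fun i j : Fin 2 => if i.val + j.val + 1 = 2 then (1 : L) else 0)).Local v) × ((cmDatum L 1 (Matrix.of fun i j : Fin 1 => if i.val + j.val + 1 = 1 then (1 : L) else 0)).Local v))) : Set (((cmDatum L 2 (Matrix.of fun i j : Fin 2 => if i.val + j.val + 1 = 2 then (1 : L) else 0)).Local v) × ((cmDatum L 1 (Matrix.of fun i j : Fin 1 => if i.val + j.val + 1 = 1 then (1 : L) else 0)).Local v))).indicator fun _ => (1 : ℂ))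
                  (ConjClasses.mk (t : (((cmDatum L 2 (Matrix.of fun i j : Fin 2 => if i.val + j.val + 1 = 2 then (1 : L) else 0)).Local v) × ((cmDatum L 1 (Matrix.of fun i j : Fin 1 => if i.val + j.val + 1 = 1 then (1 : L) else 0)).Local v)))) -
              ∑ᶠ c ∈ {c : ConjClasses (((cmDatum L 2 (Matrix.of fun i j : Fin 2 => if i.val + j.val + 1 = 2 then (1 : L) else 0)).Local v) × ((cmDatum L 1 (Matrix.of fun i j : Fin 1 => if i.val + j.val + 1 = 1 then (1 : L) else 0)).Local v)) | IsLocalStablyConjH L v (t : (((cmDatum L 2 (Matrix.of fun i j : Fin 2 => if i.val + j.val + 1 = 2 then (1 : L) else 0)).Local v) × ((cmDatum L 1 (Matrix.of fun i j : Fin 1 => if i.val + j.val + 1 = 1 then (1 : L) else 0)).Local v))) (Quotient.out c)},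
                classOrbitalIntegral m ((((cmLocalIntegralLevel L 2 (Matrix.of fun i j : Fin 2 => if i.val + j.val + 1 = 2 then (1 : L) else 0) v).prod (cmLocalIntegralLevel L 1 (Matrix.of fun i j : Fin 1 => if i.val + j.val + 1 = 1 then (1 : L) else 0) v) : Subgroup (((cmDatum L 2 (Matrix.of fun i j : Fin 2 => if i.val + j.val + 1 = 2 then (1 : L) else 0)).Local v) × ((cmDatum L 1 (Matrix.of fun i j : Fin 1 => if i.val + j.val + 1 = 1 then (1 : L) else 0)).Local v))) : Set (((cmDatum L 2 (Matrix.of fun i j : Fin 2 => if i.val + j.val + 1 = 2 then (1 : L) else 0)).Local v) × ((cmDatum L 1 (Matrix.of fun i j : Fin 1 => if i.val + j.val + 1 = 1 then (1 : L) else 0)).Local v))).indicator fun _ => (1 : ℂ)) c) =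
          fC t := by
  obtain ⟨w⟩ := PlacesOver.nonempty L v
  have hw : IsCMField.complexConj L • w.1 = w.1 := smul_eq_of_subsingleton_placesOver₁₃ L v hv w
  exact ⟨0, IsLocallyConstant.const 0, HasCompactSupport.zero, fun t hRt => rankOne_letter_lhs_indicator_eq_zero_of_ramified L v ν w hw
    (ramificationIdx'_ne_one_of_not_isUnramifiedIn L v hv hram w) μ hReg hconj hstab hm t₀ P d ht₀ hP hd1 t hRt⟩

end Ramified

end Literature.NumberTheory.Rogawski1990

end
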